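import Summits.Ventures.PercRepro.ProfileGapMonoThresholdTopCore

/-!
# PercRepro — THE `ν + q − 3` REGIME: a rank-`(q−1)` flat whose complement has dual rank `2`, and the slack it
certifies at the top threshold (p5, gen 31; `proofs/P5-GM1.md` §43)

On a coloop-free matroid a rank-`(q−1)` flat `F = cl B` with `ν + q − 3` points (`3 ≤ q`; at `q = 4` the planes of
exactly `ν + 1` points, the only open case of the top threshold after TopCore) has a complement `O = E ∖ F` of
`ρ(E) − q + 3` points and DUAL RANK `2`: `ρ(E ∖ X) + #X ≤ ρ(E) + 2` for every `X ⊆ O` (`rk_sdiff_add_card_le_of_subset_compl`).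
Hence `O` is a union of SERIES CLASSES (the relation `ρ(E ∖ {x, y}) + 1 = ρ(E)` is transitive on every coloop-free
matroid, `rk_sdiff_pair_trans`) and every three points of `O` containing a non-series pair form a cocircuit
(`rk_sdiff_triple_of_not_series`).  The rank formula behind the type tables: when every `y ∈ Y` is kept out of the
closure of the rest by a set `W ⊇ (Y ∖ y) ∪ D`, `ρ(Y ∪ D) = #Y + ρ(D)` (`rk_union_eq_card_add_of_forall`); for
`Y ⊆ O` with a series partner outside `Y` for every point, or a transversal cocircuit pair outside `Y`, this gives
`ρ(Y ∪ D) = #Y + ρ(D)` for every `D ⊆ F` (`rk_union_eq_of_series_partner`, `rk_union_eq_of_transversal`).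
THE SLACK LEMMA: for a demanding `B` (rank `q − 1`, spanning complement) with `cl B = F`, a `(q−1)`-subset `Y ⊆ O` of
co-rank `ρ(E) − 1` and a point `p ∈ F ∖ B` with `ρ(Y ∪ p) = q`, the set `S = Y ∪ p` is a boundary target of the top
threshold (`insert_mem_levelSetCoQ_top`, `rk_sdiff_insert_add_one`) and `p` is a coloop of `S` lying in the closure
of its complement (`mem_coloops_inter_clF_of_corank_two`) — one unit of the boundary slack of
`thresholdIneq_iff_excess_boundary` at `S`, the payment of the paper's §43 for the demanding bases of a long flat.
Nothing open is asserted.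
-/

open scoped Matroid

namespace PercRepro.Cogirth

open Finset ThmH Skew Shadow Profile

variable {α : Type} [DecidableEq α] {N : Matroid α} [N.Finite] {q : ℕ}

section General

/-- **Unit decrease**: removing one point lowers the rank by at most one. -/
theorem rk_le_rk_erase_succ {X : Finset α} (hX : X ⊆ gr N) (x : α) : rk N X ≤ rk N (X.erase x) + 1 := by
  by_cases hx : x ∈ X
  · have h := rk_insert_eq (hX hx) ((erase_subset x X).trans hX)
    rw [insert_erase hx] at h
    rw [h]
    split_ifs <;> omega
  · rw [erase_eq_of_notMem hx]
    omega

/-- The rank of a union is at most the rank of one part plus the size of the other. -/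
theorem rk_union_le_rk_add_card (X C : Finset α) : rk N (X ∪ C) ≤ rk N X + C.card := by
  have h1 := rk_union_add_rk_inter_le (M := N) X C
  have h2 := rk_le_card' (M := N) C
  omega

/-- **The series relation is transitive** on a coloop-free matroid: if `{x, y}` and `{y, z}` are cocircuits
(`ρ(E ∖ {x, y}) + 1 = ρ(E) = ρ(E ∖ {y, z}) + 1`) with `x ≠ z`, then so is `{x, z}`. -/
theorem rk_sdiff_pair_trans (hcf : ∀ z ∈ gr N, rk N ((gr N).erase z) = rk N (gr N)) {x y z : α}
    (hx : x ∈ gr N) (hy : y ∈ gr N) (hxz : x ≠ z)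
    (h1 : rk N (gr N \ {x, y}) + 1 = rk N (gr N)) (h2 : rk N (gr N \ {y, z}) + 1 = rk N (gr N)) :
    rk N (gr N \ {x, z}) + 1 = rk N (gr N) := by
  have hU : gr N \ {x, y} ∪ gr N \ {y, z} = (gr N).erase y := by
    ext w
    simp only [mem_union, mem_sdiff, mem_insert, mem_singleton, mem_erase, not_or]
    constructor
    · rintro (⟨hw, hwx, hwy⟩ | ⟨hw, hwy, hwz⟩) <;> exact ⟨by assumption, hw⟩
    · rintro ⟨hwy, hw⟩
      by_cases hwx : w = x
      · exact Or.inr ⟨hw, hwy, fun h => hxz (hwx ▸ h ▸ rfl)⟩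
      · exact Or.inl ⟨hw, hwx, hwy⟩
  have hI : gr N \ {x, y} ∩ (gr N \ {y, z}) = (gr N \ {x, z}).erase y := by
    ext w
    simp only [mem_inter, mem_sdiff, mem_insert, mem_singleton, mem_erase, not_or]
    tauto
  have hsub := rk_union_add_rk_inter_le (M := N) (gr N \ {x, y}) (gr N \ {y, z})
  rw [hU, hI, hcf y hy] at hsub
  have h3 := rk_le_rk_erase_succ (N := N) (sdiff_subset : gr N \ {x, z} ⊆ gr N) y
  have h4 : gr N \ {x, z} = ((gr N).erase x).erase z := by
    ext w
    simp only [mem_sdiff, mem_insert, mem_singleton, mem_erase, not_or]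
    tauto
  have h5 := rk_le_rk_erase_succ (N := N) (erase_subset x (gr N)) z
  rw [hcf x hx] at h5
  rw [h4] at hsub h3 ⊢
  omega

/-- **The rank formula**: if every `y ∈ Y` is kept out of the closure of `(Y ∖ y) ∪ D` by a set `W ⊇ (Y ∖ y) ∪ D`
with `y ∉ cl W`, then `ρ(Y ∪ D) = #Y + ρ(D)`. -/
theorem rk_union_eq_card_add_of_forall (D : Finset α) (hD : D ⊆ gr N) (Y : Finset α) :
    Y ⊆ gr N → (∀ y ∈ Y, ∃ W ⊆ gr N, Y.erase y ∪ D ⊆ W ∧ y ∉ clF N W) → rk N (Y ∪ D) = Y.card + rk N D := by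
  induction Y using Finset.induction_on with
  | empty =>
    intro _ _
    simp only [empty_union, card_empty, zero_add]
  | insert y Y hyY ih =>
    intro hY h
    have hY' : Y ⊆ gr N := (subset_insert y Y).trans hY
    have hrec : rk N (Y ∪ D) = Y.card + rk N D := by
      refine ih hY' fun y' hy' => ?_
      obtain ⟨W, hW, hsub, hnot⟩ := h y' (mem_insert_of_mem hy')
      refine ⟨W, hW, ?_, hnot⟩
      refine (union_subset_union (erase_subset_erase y' (subset_insert y Y)) (Subset.refl D)).trans hsub
    obtain ⟨W, hW, hsub, hnot⟩ := h y (mem_insert_self y Y)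
    rw [erase_insert hyY] at hsub
    have hnot' : y ∉ clF N (Y ∪ D) := fun hc => hnot (clF_mono hsub hc)
    rw [insert_union, rk_insert_eq (hY (mem_insert_self y Y)) (union_subset hY' hD), if_neg hnot', hrec,
      card_insert_of_notMem hyY]
    omega

end General

section CorankTwo

variable (hcf : ∀ z ∈ gr N, rk N ((gr N).erase z) = rk N (gr N)) {B : Finset α} (hB : B ∈ Rq N (q - 1))
  (hF : (clF N B).card + rk N (gr N) = (gr N).card + (q - 3))

omit [DecidableEq α] in
include hB in
/-- The rank of the flat `cl B` is `q − 1`. -/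
theorem rk_clF_of_mem_Rq : rk N (clF N B) = q - 1 := by
  rw [rk_clF]
  exact rk_eq_of_eRk_eq (mem_Rq.1 hB).2

include hB hF in
/-- **THE COMPLEMENT HAS DUAL RANK `2`**: for `X ⊆ E ∖ cl B`, `ρ(E ∖ X) + #X ≤ ρ(E) + 2` (`3 ≤ q`). -/
theorem rk_sdiff_add_card_le_of_subset_compl (hq : 3 ≤ q) {X : Finset α} (hX : X ⊆ gr N \ clF N B) :
    rk N (gr N \ X) + X.card ≤ rk N (gr N) + 2 := by
  have hcl : clF N B ⊆ gr N := clF_subset_gr B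
  have hsplit : gr N \ X = clF N B ∪ ((gr N \ clF N B) \ X) := by
    ext w
    simp only [mem_union, mem_sdiff]
    constructor
    · rintro ⟨hw, hwX⟩
      by_cases hc : w ∈ clF N B
      · exact Or.inl hc
      · exact Or.inr ⟨⟨hw, hc⟩, hwX⟩
    · rintro (hc | ⟨⟨hw, _⟩, hwX⟩)
      · exact ⟨hcl hc, fun hwX => (mem_sdiff.1 (hX hwX)).2 hc⟩
      · exact ⟨hw, hwX⟩
  have h1 := rk_union_le_rk_add_card (N := N) (clF N B) ((gr N \ clF N B) \ X)
  have h2 : ((gr N \ clF N B) \ X).card + X.card = (gr N \ clF N B).card := card_sdiff_add_card_eq_card hX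
  have h3 : (gr N \ clF N B).card + (clF N B).card = (gr N).card := card_sdiff_add_card_eq_card hcl
  have h4 := rk_clF_of_mem_Rq hB
  rw [hsplit]
  omega

include hB hF in
/-- **Three points of the complement containing a non-series pair form a cocircuit** (`3 ≤ q`): `x, y, z ∈ E ∖ cl B`
distinct with `ρ(E ∖ {x, y}) = ρ(E)` give `ρ(E ∖ {x, y, z}) + 1 = ρ(E)`. -/
theorem rk_sdiff_triple_of_not_series (hq : 3 ≤ q) {x y z : α} (hx : x ∈ gr N \ clF N B)
    (hy : y ∈ gr N \ clF N B) (hz : z ∈ gr N \ clF N B) (hxy : x ≠ y) (hxz : x ≠ z) (hyz : y ≠ z)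
    (h2 : rk N (gr N \ {x, y}) = rk N (gr N)) : rk N (gr N \ {x, y, z}) + 1 = rk N (gr N) := by
  have hsub : ({x, y, z} : Finset α) ⊆ gr N \ clF N B := by
    intro w hw
    simp only [mem_insert, mem_singleton] at hw
    rcases hw with rfl | rfl | rfl <;> assumption
  have hcard : ({x, y, z} : Finset α).card = 3 := by
    rw [card_insert_of_notMem, card_insert_of_notMem, card_singleton]
    · simp only [mem_singleton]; exact hyz
    · simp only [mem_insert, mem_singleton, not_or]; exact ⟨hxy, hxz⟩
  have hle := rk_sdiff_add_card_le_of_subset_compl hB hF hq hsub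
  rw [hcard] at hle
  have hge : rk N (gr N \ {x, y}) ≤ rk N (gr N \ {x, y, z}) + 1 := by
    have h := rk_le_rk_erase_succ (N := N) (sdiff_subset : gr N \ {x, y} ⊆ gr N) z
    have heq : (gr N \ {x, y}).erase z = gr N \ {x, y, z} := by
      ext w
      simp only [mem_erase, mem_sdiff, mem_insert, mem_singleton, not_or]
      tauto
    rw [heq] at h
    exact h
  omega

/-- **The rank formula with series partners**: `Y ⊆ E ∖ cl B` such that every `y ∈ Y` has a series partner
`o ∉ Y` outside `cl B` (`ρ(E ∖ {y, o}) + 1 = ρ(E)`), and `D ⊆ cl B`: `ρ(Y ∪ D) = #Y + ρ(D)` (coloop-free). -/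
theorem rk_union_eq_of_series_partner (hcf : ∀ z ∈ gr N, rk N ((gr N).erase z) = rk N (gr N)) {Y D : Finset α}
    (hY : Y ⊆ gr N \ clF N B) (hD : D ⊆ clF N B)
    (h : ∀ y ∈ Y, ∃ o ∈ gr N \ clF N B, o ∉ Y ∧ o ≠ y ∧ rk N (gr N \ {y, o}) + 1 = rk N (gr N)) :
    rk N (Y ∪ D) = Y.card + rk N D := by
  have hcl : clF N B ⊆ gr N := clF_subset_gr B
  refine rk_union_eq_card_add_of_forall D (hD.trans hcl) Y (hY.trans sdiff_subset) fun y hy => ?_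
  obtain ⟨o, ho, hoY, hoy, hser⟩ := h y hy
  refine ⟨gr N \ {y, o}, sdiff_subset, ?_, ?_⟩
  · intro w hw
    rcases mem_union.1 hw with hw | hw
    · obtain ⟨hwy, hwY⟩ := mem_erase.1 hw
      refine mem_sdiff.2 ⟨(mem_sdiff.1 (hY hwY)).1, ?_⟩
      simp only [mem_insert, mem_singleton, not_or]
      exact ⟨hwy, fun h => hoY (h ▸ hwY)⟩
    · refine mem_sdiff.2 ⟨hcl (hD hw), ?_⟩
      simp only [mem_insert, mem_singleton, not_or]
      exact ⟨fun h => (mem_sdiff.1 (hY hy)).2 (h ▸ hD hw), fun h => (mem_sdiff.1 ho).2 (h ▸ hD hw)⟩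
  · rw [mem_clF_iff_rk_insert (mem_sdiff.1 (hY hy)).1 sdiff_subset]
    have heq : insert y (gr N \ {y, o}) = (gr N).erase o := by
      ext w
      simp only [mem_insert, mem_sdiff, mem_singleton, mem_erase, not_or]
      constructor
      · rintro (rfl | ⟨hw, hwy, hwo⟩)
        · exact ⟨fun h => hoy h.symm, (mem_sdiff.1 (hY hy)).1⟩
        · exact ⟨hwo, hw⟩
      · rintro ⟨hwo, hw⟩
        by_cases hwy : w = y
        · exact Or.inl hwy
        · exact Or.inr ⟨hw, hwy, hwo⟩
    rw [heq, hcf o (mem_sdiff.1 ho).1]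
    omega

/-- **The rank formula with transversal pairs**: `Y ⊆ E ∖ cl B` such that every `y ∈ Y` has two points
`o ≠ o'` of `E ∖ cl B` outside `Y`, not in series with each other (`ρ(E ∖ {o, o'}) = ρ(E)`), with `{y, o, o'}` a
cocircuit (`ρ(E ∖ {y, o, o'}) + 1 = ρ(E)`), and `D ⊆ cl B`: `ρ(Y ∪ D) = #Y + ρ(D)`. -/
theorem rk_union_eq_of_transversal {Y D : Finset α} (hY : Y ⊆ gr N \ clF N B) (hD : D ⊆ clF N B)
    (h : ∀ y ∈ Y, ∃ o ∈ gr N \ clF N B, ∃ o' ∈ gr N \ clF N B, o ∉ Y ∧ o' ∉ Y ∧ o ≠ y ∧ o' ≠ y ∧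
      rk N (gr N \ {o, o'}) = rk N (gr N) ∧ rk N (gr N \ {y, o, o'}) + 1 = rk N (gr N)) :
    rk N (Y ∪ D) = Y.card + rk N D := by
  have hcl : clF N B ⊆ gr N := clF_subset_gr B
  refine rk_union_eq_card_add_of_forall D (hD.trans hcl) Y (hY.trans sdiff_subset) fun y hy => ?_
  obtain ⟨o, ho, o', ho', hoY, ho'Y, hoy, ho'y, hoo', htri⟩ := h y hy
  refine ⟨gr N \ {y, o, o'}, sdiff_subset, ?_, ?_⟩
  · intro w hw
    rcases mem_union.1 hw with hw | hw
    · obtain ⟨hwy, hwY⟩ := mem_erase.1 hw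
      refine mem_sdiff.2 ⟨(mem_sdiff.1 (hY hwY)).1, ?_⟩
      simp only [mem_insert, mem_singleton, not_or]
      exact ⟨hwy, fun h => hoY (h ▸ hwY), fun h => ho'Y (h ▸ hwY)⟩
    · refine mem_sdiff.2 ⟨hcl (hD hw), ?_⟩
      simp only [mem_insert, mem_singleton, not_or]
      exact ⟨fun h => (mem_sdiff.1 (hY hy)).2 (h ▸ hD hw), fun h => (mem_sdiff.1 ho).2 (h ▸ hD hw),
        fun h => (mem_sdiff.1 ho').2 (h ▸ hD hw)⟩
  · rw [mem_clF_iff_rk_insert (mem_sdiff.1 (hY hy)).1 sdiff_subset]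
    have heq : insert y (gr N \ {y, o, o'}) = gr N \ {o, o'} := by
      ext w
      simp only [mem_insert, mem_sdiff, mem_singleton, not_or]
      constructor
      · rintro (rfl | ⟨hw, _, hwo, hwo'⟩)
        · exact ⟨(mem_sdiff.1 (hY hy)).1, fun h => hoy h.symm, fun h => ho'y h.symm⟩
        · exact ⟨hw, hwo, hwo'⟩
      · rintro ⟨hw, hwo, hwo'⟩
        by_cases hwy : w = y
        · exact Or.inl hwy
        · exact Or.inr ⟨hw, hwy, hwo, hwo'⟩
    rw [heq, hoo']
    omega

end CorankTwo

section Slack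

variable {B : Finset α} (hB : B ∈ Rq N (q - 1)) (hBsp : rk N (gr N \ B) = rk N (gr N))
  {Y : Finset α} (hY : Y ⊆ gr N \ clF N B) (hYc : Y.card = q - 1) (hYco : rk N (gr N \ Y) + 1 = rk N (gr N))
  {p : α} (hp : p ∈ clF N B) (hpB : p ∉ B) (hS : rk N (insert p Y) = q)

include hB hY hp hpB in
/-- The complement of `Y ∪ p` together with `p` is the complement of `Y`, and `B` lies in the complement of
`Y ∪ p`. -/
theorem sdiff_insert_facts :
    gr N \ Y = insert p (gr N \ insert p Y) ∧ B ⊆ gr N \ insert p Y := by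
  have hcl : clF N B ⊆ gr N := clF_subset_gr B
  have hBg : B ⊆ gr N := (mem_Rq.1 hB).1
  have hpY : p ∉ Y := fun h => (mem_sdiff.1 (hY h)).2 hp
  constructor
  · ext w
    simp only [mem_sdiff, mem_insert, not_or]
    constructor
    · rintro ⟨hw, hwY⟩
      by_cases hwp : w = p
      · exact Or.inl hwp
      · exact Or.inr ⟨hw, hwp, hwY⟩
    · rintro (rfl | ⟨hw, _, hwY⟩)
      · exact ⟨hcl hp, hpY⟩
      · exact ⟨hw, hwY⟩
  · intro b hb
    refine mem_sdiff.2 ⟨hBg hb, ?_⟩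
    simp only [mem_insert, not_or]
    exact ⟨fun h => hpB (h ▸ hb), fun h => (mem_sdiff.1 (hY h)).2 (subset_clF hBg hb)⟩

include hB hY hYco hp hpB in
/-- **`Y ∪ p` is a boundary target**: `ρ(E ∖ (Y ∪ p)) + 1 = ρ(E)` — the complement of `Y ∪ p` contains `B`, whose
closure holds `p`, so it has the rank of the complement of `Y`. -/
theorem rk_sdiff_insert_add_one : rk N (gr N \ insert p Y) + 1 = rk N (gr N) := by
  obtain ⟨h1, h2⟩ := sdiff_insert_facts hB hY hp hpB
  have hpcl : p ∈ clF N (gr N \ insert p Y) := clF_mono h2 hp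
  have h3 := rk_insert_eq (clF_subset_gr B hp) (sdiff_subset : gr N \ insert p Y ⊆ gr N)
  rw [if_pos hpcl, ← h1] at h3
  omega

include hB hY hYco hp hpB hS in
/-- **`Y ∪ p` lies in the top-threshold target family** `levelSetCoQ N (ρ(E) − 1) q`. -/
theorem insert_mem_levelSetCoQ_top : insert p Y ∈ levelSetCoQ N (rk N (gr N) - 1) q := by
  refine mem_levelSetCoQ.2 ⟨⟨?_, ?_⟩, ?_⟩
  · exact insert_subset (clF_subset_gr B hp) (hY.trans sdiff_subset)
  · rw [← coe_rk, hS]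
  · have := rk_sdiff_insert_add_one hB hY hYco hp hpB
    omega

include hB hY hYc hp hpB hS in
/-- **THE SLACK CERTIFICATE**: `p` is a coloop of `S = Y ∪ p` (`ρ(Y) ≤ q − 1 < q = ρ(S)`) lying in the closure of
the complement of `S` (which contains `B`, whose closure is the flat through `p`): one unit of the boundary slack of
`thresholdIneq_iff_excess_boundary` at `S`. -/
theorem mem_coloops_inter_clF_of_corank_two (hq : 1 ≤ q) :
    p ∈ coloops N (insert p Y) ∩ clF N (gr N \ insert p Y) := by
  obtain ⟨_, h2⟩ := sdiff_insert_facts hB hY hp hpB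
  have hpY : p ∉ Y := fun h => (mem_sdiff.1 (hY h)).2 hp
  refine mem_inter.2 ⟨mem_coloops.2 ⟨mem_insert_self p Y, ?_⟩, clF_mono h2 hp⟩
  rw [erase_insert hpY]
  intro hc
  rw [mem_clF_iff_rk_insert (clF_subset_gr B hp) (hY.trans sdiff_subset)] at hc
  have := rk_le_card' (M := N) Y
  omega

include hB hY hYc hp hpB hS in
/-- The boundary term of `S = Y ∪ p` is at least one. -/
theorem one_le_card_coloops_inter_clF_of_corank_two (hq : 1 ≤ q) :
    1 ≤ (coloops N (insert p Y) ∩ clF N (gr N \ insert p Y)).card :=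
  card_pos.2 ⟨p, mem_coloops_inter_clF_of_corank_two hB hY hYc hp hpB hS hq⟩

end Slack

end PercRepro.Cogirth
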